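import Summits.Ventures.QEC.CircuitDistance.SchedValueBB144o345
import Summits.Ventures.QEC.CircuitDistance.PortBB144ValueStd
import HarnessLib

/-!
# Q4 corollary: CNOT order #204 (print's order as written) versus order #345 of `[[144,12,12]]` — `10` versus `11` at every `N_c ≥ 1`
# (venture QEC, experiment cell CDX, L11; corollary clause of the Q4 row T-109; seat qec-cdx-type-2 (g1 staged, g2 typed))

Composition, in the semantics of record (`SyndromeCycle` / `SMSchedule`: same qubits, same CNOT set per check, same fault, detector and
logical-error semantics; the two orders differ only in the time order of the 12 CNOT layers), of the two landed std words:
* `bb144_circuitDistance_eq_ten_std` (T-106, `PortBB144ValueStd`): `d_circ = 10` for print's CNOT order as written (`bb144SM`,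
  `SyndromeCycle.cycleEvents`; as a schedule, `sched204 = orders936.json[204]`, bridged by the anchor `circuitDistanceₛ_sched204_bb144`);
* `sched345_circuitDistance_eq_eleven` (T-109, `SchedValueBB144o345`): `d_circ = 11` for order #345.
Internal sentence (director R180 (7), fixed): «in the semantics of record, re-timing the `[[144,12,12]]` syndrome circuit from print's CNOT
order as written (`d_circ = 10`, T-106) to order #345 (numbering ours) raises the certified circuit distance to `11`».  RIDER L (positional
labelling of record); EXT rider: variant numbering ours (`orders936.json`, criterion O1); identification of #345 with a printed variant OPEN
(acq-14097).  This compares two of OUR certified orders; it is not a comparison against any printed claim, and nothing here is a threshold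
or a decoding statement.
-/

namespace Summit.Ventures.QEC.CircuitDistance

open Literature.InformationTheory.QuantumCodes

/-- **Orders #204 and #345 side by side (ₛ-form)**: `d_circ(sched204) = 10` and `d_circ(sched345) = 11` at every `N_c ≥ 1`. -/
theorem sched204_ten_and_sched345_eleven :
    ∀ Nc : ℕ, 1 ≤ Nc → circuitDistanceₛ sched204 bb144SM Nc = 10 ∧ circuitDistanceₛ sched345 bb144SM Nc = 11 := fun Nc hNc =>
  ⟨(circuitDistanceₛ_sched204_bb144 Nc).trans (bb144_circuitDistance_eq_ten_std Nc hNc), sched345_circuitDistance_eq_eleven Nc hNc⟩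

/-- ★ **Order #345 versus print's order as written**: for every `N_c ≥ 1` the certified circuit distance of `[[144,12,12]]` under CNOT
order #345 (`circuitDistanceₛ sched345`) exceeds the one of the circuit as written (`circuitDistance bb144SM`): `10 < 11`. -/
theorem sched345_circuitDistance_gt_sched204 :
    ∀ Nc : ℕ, 1 ≤ Nc → circuitDistance bb144SM Nc < circuitDistanceₛ sched345 bb144SM Nc := fun Nc hNc => by
  rw [bb144_circuitDistance_eq_ten_std Nc hNc, sched345_circuitDistance_eq_eleven Nc hNc]; norm_num

/-- The same comparison with both sides in the schedule-parametrised form: `circuitDistanceₛ sched204 < circuitDistanceₛ sched345` at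
every `N_c ≥ 1` (one rewrite by the anchor `circuitDistanceₛ_sched204_bb144`). -/
theorem sched204_circuitDistanceₛ_lt_sched345 :
    ∀ Nc : ℕ, 1 ≤ Nc → circuitDistanceₛ sched204 bb144SM Nc < circuitDistanceₛ sched345 bb144SM Nc := fun Nc hNc => by
  rw [circuitDistanceₛ_sched204_bb144]; exact sched345_circuitDistance_gt_sched204 Nc hNc

/-- Instance `N_c = 1`: `(10, 11)`. -/
example : circuitDistanceₛ sched204 bb144SM 1 = 10 ∧ circuitDistanceₛ sched345 bb144SM 1 = 11 :=
  sched204_ten_and_sched345_eleven 1 le_rfl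

end Summit.Ventures.QEC.CircuitDistance
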